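/-
Copyright (c) 2026. All rights reserved.
Released under Apache 2.0 license as described in the file LICENSE.
-/
import Mathlib
import Summits.RiemannHypothesis.RiemannHypothesis.Theorems.HandoffLatticeUncertainty
import Literature.Analysis.FunctionSpaces.PlancherelL1L2
import HarnessLib

/-!
# Towards L-EL: polarised Plancherel, the leakage quadratic, and the averaging step

`HANDOFF/prove-1` gen15, ATTEMPT-22 §6 (S22-d) / idea-1 IDEAS-prolate §131.3 «L-EL» (the
Euler–Lagrange characterisation of SLAVED completions: a completion whose inner block minimises the
leakage `∫_{|ξ|≥λ} |𝓕F|²` among inner perturbations equals its band-limited part plus a constant on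
the inner zone). This file proves three of the four steps of that characterisation, all RH-free and
of independent use:

* `integral_conj_fourier_mul_eq` — **polarised Plancherel on `L¹ ∩ L²(ℝ)`**:
  `∫ conj(𝓕F)·𝓕k = ∫ conj(F)·k` (from the tree's norm form, Titchmarsh *Fourier Integrals* Thm 48,
  by polarisation with `k` and `i·k`);
* `leakage_add_mul` — STEP 1: `leakage λ (F + t·k) = leakage λ F + 2t·Re ∫_{|ξ|≥λ} conj(𝓕F)𝓕k
  + t²·leakage λ k` (`leakage` of `HandoffLatticeUncertainty`);
* STEP 2 (a real quadratic minimal at `0` has no linear term) is the tree's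
  `Literature.Probability.LatticeModels.DiscreteRect.eq_zero_of_forall_le_add_quad`;
* `ae_eq_const_of_orthogonal_inner` — STEP 4 (averaging trick in place of du Bois-Reymond): an even
  `H`, square-integrable on `I = (-1/λ, 1/λ)` and orthogonal to every even, mean-zero `L¹ ∩ L²`
  perturbation supported in `I`, is a.e. constant on `I`.

The remaining STEP 3 (moving `∫_{|ξ|≥λ} conj(𝓕F)𝓕k` to the `x`-side against `F − D_λF`) is the
polarised Plancherel above minus a band-limited Fubini identity, left to a successor; existence of
slaved completions is not addressed. Nothing here bears on the truth of RH.
-/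

set_option linter.dupNamespace false

noncomputable section

open MeasureTheory Set Complex
open scoped FourierTransform

namespace Summit.RiemannHypothesis.RiemannHypothesis.Theorems

namespace LatticeUncertainty.SlavedEL


/-- `‖a + b‖² = ‖a‖² + 2·Re(conj a · b) + ‖b‖²` in `ℂ`. -/
theorem norm_add_sq_complex (a b : ℂ) :
    ‖a + b‖ ^ 2 = ‖a‖ ^ 2 + 2 * (starRingEnd ℂ a * b).re + ‖b‖ ^ 2 := by
  rw [Complex.sq_norm, Complex.sq_norm, Complex.sq_norm, Complex.normSq_add]
  have : (a * starRingEnd ℂ b).re = (starRingEnd ℂ a * b).re := by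
    rw [← Complex.conj_re (a * starRingEnd ℂ b), map_mul, Complex.conj_conj, mul_comm]
  rw [this]; ring

/-- `conj f · g` is integrable when `‖f‖², ‖g‖²` are (AM–GM). -/
theorem integrable_conj_mul_of_sq {μ : Measure ℝ} {f g : ℝ → ℂ}
    (hfm : AEStronglyMeasurable f μ) (hgm : AEStronglyMeasurable g μ)
    (hf : Integrable (fun x ↦ ‖f x‖ ^ 2) μ) (hg : Integrable (fun x ↦ ‖g x‖ ^ 2) μ) :
    Integrable (fun x ↦ starRingEnd ℂ (f x) * g x) μ := by
  refine Integrable.mono' (hf.add hg)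
    ((Complex.continuous_conj.comp_aestronglyMeasurable hfm).mul hgm) (ae_of_all _ fun x ↦ ?_)
  rw [norm_mul, Complex.norm_conj]
  simp only [Pi.add_apply]
  nlinarith [sq_nonneg (‖f x‖ - ‖g x‖)]

/-- `∫ ‖f + g‖² = ∫ ‖f‖² + 2·Re ∫ conj f · g + ∫ ‖g‖²`. -/
theorem integral_norm_sq_add {μ : Measure ℝ} {f g : ℝ → ℂ}
    (hfm : AEStronglyMeasurable f μ) (hgm : AEStronglyMeasurable g μ)
    (hf : Integrable (fun x ↦ ‖f x‖ ^ 2) μ) (hg : Integrable (fun x ↦ ‖g x‖ ^ 2) μ) :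
    ∫ x, ‖f x + g x‖ ^ 2 ∂μ =
      (∫ x, ‖f x‖ ^ 2 ∂μ) + 2 * (∫ x, starRingEnd ℂ (f x) * g x ∂μ).re + ∫ x, ‖g x‖ ^ 2 ∂μ := by
  have hX := integrable_conj_mul_of_sq hfm hgm hf hg
  have hXre : Integrable (fun x ↦ (starRingEnd ℂ (f x) * g x).re) μ := hX.re
  simp_rw [norm_add_sq_complex]
  have e1 : ∫ x, (‖f x‖ ^ 2 + 2 * (starRingEnd ℂ (f x) * g x).re + ‖g x‖ ^ 2) ∂μ
      = (∫ x, (‖f x‖ ^ 2 + 2 * (starRingEnd ℂ (f x) * g x).re) ∂μ) + ∫ x, ‖g x‖ ^ 2 ∂μ :=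
    integral_add (hf.add (hXre.const_mul _)) hg
  have e2 : ∫ x, (‖f x‖ ^ 2 + 2 * (starRingEnd ℂ (f x) * g x).re) ∂μ
      = (∫ x, ‖f x‖ ^ 2 ∂μ) + ∫ x, 2 * (starRingEnd ℂ (f x) * g x).re ∂μ :=
    integral_add hf (hXre.const_mul _)
  rw [e1, e2, integral_const_mul]
  have e3 : ∫ a, (starRingEnd ℂ (f a) * g a).re ∂μ = (∫ x, starRingEnd ℂ (f x) * g x ∂μ).re := by
    have := integral_re hX
    simpa only [RCLike.re_to_complex] using this
  rw [e3]

/-- `‖𝓕 f‖²` is integrable for `f ∈ L¹ ∩ L²` (tree Plancherel). -/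
theorem integrable_sq_norm_fourier' {f : ℝ → ℂ} (h1 : Integrable f) (h2 : MemLp f 2) :
    Integrable (fun ξ ↦ ‖𝓕 f ξ‖ ^ 2) := by
  have hm := Literature.Analysis.FunctionSpaces.memLp_two_fourierIntegral h1 h2
  exact (memLp_two_iff_integrable_sq_norm hm.1).mp hm

/-- Real parts: `Re ∫ conj(𝓕F)𝓕k = Re ∫ conj(F)k`. -/
theorem re_integral_conj_fourier_mul_eq {F k : ℝ → ℂ} (hF : Integrable F) (hF2 : MemLp F 2)
    (hk : Integrable k) (hk2 : MemLp k 2) :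
    (∫ ξ, starRingEnd ℂ (𝓕 F ξ) * 𝓕 k ξ).re = (∫ x, starRingEnd ℂ (F x) * k x).re := by
  have PF := Literature.Analysis.FunctionSpaces.integral_norm_sq_fourierIntegral_eq hF hF2
  have Pk := Literature.Analysis.FunctionSpaces.integral_norm_sq_fourierIntegral_eq hk hk2
  have PFk := Literature.Analysis.FunctionSpaces.integral_norm_sq_fourierIntegral_eq
    (hF.add hk) (hF2.add hk2)
  have hcF : Continuous (𝓕 F) := Literature.Analysis.FunctionSpaces.continuous_fourierIntegral hF
  have hck : Continuous (𝓕 k) := Literature.Analysis.FunctionSpaces.continuous_fourierIntegral hk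
  have sF : Integrable (fun x ↦ ‖F x‖ ^ 2) := (memLp_two_iff_integrable_sq_norm hF2.1).mp hF2
  have sk : Integrable (fun x ↦ ‖k x‖ ^ 2) := (memLp_two_iff_integrable_sq_norm hk2.1).mp hk2
  have L := integral_norm_sq_add hcF.aestronglyMeasurable hck.aestronglyMeasurable
    (integrable_sq_norm_fourier' hF hF2) (integrable_sq_norm_fourier' hk hk2)
  have R := integral_norm_sq_add hF.aestronglyMeasurable hk.aestronglyMeasurable sF sk
  -- additivity of `𝓕` on `L¹` (Mathlib `VectorFourier.fourierIntegral_add`; pointwise form =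
  -- `Literature.Analysis.SpecialFunctions.fourier_add_apply`)
  have hadd : 𝓕 (F + k) = 𝓕 F + 𝓕 k :=
    VectorFourier.fourierIntegral_add Real.continuous_fourierChar (L := innerₗ ℝ) continuous_inner
      hF hk
  have hlin : (fun ξ ↦ ‖𝓕 (F + k) ξ‖ ^ 2) = fun ξ ↦ ‖𝓕 F ξ + 𝓕 k ξ‖ ^ 2 := by
    ext ξ; rw [hadd, Pi.add_apply]
  have PFk' : ∫ ξ, ‖𝓕 F ξ + 𝓕 k ξ‖ ^ 2 = ∫ x, ‖F x + k x‖ ^ 2 := by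
    rw [← hlin]; simpa using PFk
  rw [L, R, PF, Pk] at PFk'
  linarith

/-- **Polarised Plancherel on `L¹ ∩ L²`.** `∫ conj(𝓕F)·𝓕k = ∫ conj(F)·k`. -/
theorem integral_conj_fourier_mul_eq {F k : ℝ → ℂ} (hF : Integrable F) (hF2 : MemLp F 2)
    (hk : Integrable k) (hk2 : MemLp k 2) :
    ∫ ξ, starRingEnd ℂ (𝓕 F ξ) * 𝓕 k ξ = ∫ x, starRingEnd ℂ (F x) * k x := by
  have hre := re_integral_conj_fourier_mul_eq hF hF2 hk hk2
  -- imaginary parts via `k ↦ I·k`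
  have hIk : Integrable (fun x ↦ I * k x) := hk.const_mul I
  have hIk2 : MemLp (fun x ↦ I * k x) 2 := hk2.const_mul I
  have him := re_integral_conj_fourier_mul_eq hF hF2 hIk hIk2
  have e1 : ∫ ξ, starRingEnd ℂ (𝓕 F ξ) * 𝓕 (fun x ↦ I * k x) ξ =
      I * ∫ ξ, starRingEnd ℂ (𝓕 F ξ) * 𝓕 k ξ := by
    rw [← integral_const_mul]
    -- homogeneity of `𝓕` (Mathlib `VectorFourier.fourierIntegral_const_smul`; pointwise form =
    -- `Literature.Analysis.SpecialFunctions.fourier_const_mul_apply`)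
    have hsm : 𝓕 (fun x ↦ I * k x) = fun ξ ↦ I * 𝓕 k ξ := by
      have := VectorFourier.fourierIntegral_const_smul Real.fourierChar volume (innerₗ ℝ) k I
      ext ξ
      exact congrFun this ξ
    refine integral_congr_ae (ae_of_all _ fun ξ ↦ ?_)
    simp only
    rw [hsm]; ring
  have e2 : ∫ x, starRingEnd ℂ (F x) * (I * k x) = I * ∫ x, starRingEnd ℂ (F x) * k x := by
    rw [← integral_const_mul]
    refine integral_congr_ae (ae_of_all _ fun x ↦ ?_)
    simp only
    ring
  rw [e1, e2, Complex.I_mul_re, Complex.I_mul_re, neg_inj] at him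
  exact Complex.ext hre him



/-- Linearity of `𝓕` on `L¹`: `𝓕(F + c·k) = 𝓕F + c·𝓕k` pointwise. -/
theorem fourier_add_const_mul {F k : ℝ → ℂ} (hF : Integrable F) (hk : Integrable k) (c : ℂ)
    (ξ : ℝ) : 𝓕 (F + fun x ↦ c * k x) ξ = 𝓕 F ξ + c * 𝓕 k ξ := by
  rw [Real.fourier_eq, Real.fourier_eq, Real.fourier_eq, ← integral_const_mul, ← integral_add]
  · refine integral_congr_ae (ae_of_all _ fun v ↦ ?_)
    simp only [Pi.add_apply, smul_add, Circle.smul_def, smul_eq_mul]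
    ring
  · exact (Real.fourierIntegral_convergent_iff ξ).2 hF
  · exact ((Real.fourierIntegral_convergent_iff ξ).2 hk).const_mul c

/-- `conj(𝓕F)·𝓕k` is integrable for `F, k ∈ L¹ ∩ L²` (AM–GM against `‖𝓕F‖² + ‖𝓕k‖²`). -/
theorem integrable_conj_fourier_mul {F k : ℝ → ℂ} (hF : Integrable F) (hF2 : MemLp F 2)
    (hk : Integrable k) (hk2 : MemLp k 2) :
    Integrable (fun ξ ↦ starRingEnd ℂ (𝓕 F ξ) * 𝓕 k ξ) := by
  have hcF : Continuous (𝓕 F) := Literature.Analysis.FunctionSpaces.continuous_fourierIntegral hF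
  have hck : Continuous (𝓕 k) := Literature.Analysis.FunctionSpaces.continuous_fourierIntegral hk
  refine Integrable.mono' ((integrable_sq_norm_fourier' hF hF2).add (integrable_sq_norm_fourier' hk hk2))
    ((Complex.continuous_conj.comp hcF).mul hck).aestronglyMeasurable (ae_of_all _ fun ξ ↦ ?_)
  rw [norm_mul, Complex.norm_conj]
  simp only [Pi.add_apply]
  nlinarith [sq_nonneg (‖𝓕 F ξ‖ - ‖𝓕 k ξ‖)]

/-- **Step 1 of L-EL.** The leakage of `F + t·k` is a real quadratic in `t`. -/
theorem leakage_add_mul (lam : ℝ) {F k : ℝ → ℂ} (hF : Integrable F) (hF2 : MemLp F 2)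
    (hk : Integrable k) (hk2 : MemLp k 2) (t : ℝ) :
    leakage lam (F + fun x ↦ (t : ℂ) * k x) =
      leakage lam F + 2 * t * (∫ ξ in {ξ : ℝ | lam ≤ |ξ|}, starRingEnd ℂ (𝓕 F ξ) * 𝓕 k ξ).re
        + t ^ 2 * leakage lam k := by
  set S : Set ℝ := {ξ : ℝ | lam ≤ |ξ|} with hS
  have iF := (integrable_sq_norm_fourier' hF hF2).integrableOn (s := S)
  have ik := (integrable_sq_norm_fourier' hk hk2).integrableOn (s := S)
  have iX := (integrable_conj_fourier_mul hF hF2 hk hk2).integrableOn (s := S)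
  have iXre : IntegrableOn (fun ξ ↦ (starRingEnd ℂ (𝓕 F ξ) * 𝓕 k ξ).re) S := iX.re
  -- pointwise expansion
  have hpt : ∀ ξ, ‖𝓕 (F + fun x ↦ (t : ℂ) * k x) ξ‖ ^ 2 =
      ‖𝓕 F ξ‖ ^ 2 + 2 * t * (starRingEnd ℂ (𝓕 F ξ) * 𝓕 k ξ).re + t ^ 2 * ‖𝓕 k ξ‖ ^ 2 := by
    intro ξ
    rw [fourier_add_const_mul hF hk, Complex.sq_norm, Complex.sq_norm, Complex.sq_norm,
      Complex.normSq_add]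
    have h1 : Complex.normSq ((t : ℂ) * 𝓕 k ξ) = t ^ 2 * Complex.normSq (𝓕 k ξ) := by
      rw [Complex.normSq_mul, Complex.normSq_ofReal]; ring
    have h2 : (𝓕 F ξ * starRingEnd ℂ ((t : ℂ) * 𝓕 k ξ)).re =
        t * (starRingEnd ℂ (𝓕 F ξ) * 𝓕 k ξ).re := by
      rw [map_mul, Complex.conj_ofReal]
      have : (𝓕 F ξ * ((t : ℂ) * starRingEnd ℂ (𝓕 k ξ))) =
          (t : ℂ) * (𝓕 F ξ * starRingEnd ℂ (𝓕 k ξ)) := by ring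
      rw [this, Complex.re_ofReal_mul]
      congr 1
      rw [← Complex.conj_re (𝓕 F ξ * starRingEnd ℂ (𝓕 k ξ)), map_mul, Complex.conj_conj, mul_comm]
    rw [h1, h2]; ring
  unfold leakage
  rw [← hS]
  simp_rw [hpt]
  have e1 : ∫ ξ in S, (‖𝓕 F ξ‖ ^ 2 + 2 * t * (starRingEnd ℂ (𝓕 F ξ) * 𝓕 k ξ).re + t ^ 2 * ‖𝓕 k ξ‖ ^ 2)
      = (∫ ξ in S, (‖𝓕 F ξ‖ ^ 2 + 2 * t * (starRingEnd ℂ (𝓕 F ξ) * 𝓕 k ξ).re))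
        + ∫ ξ in S, t ^ 2 * ‖𝓕 k ξ‖ ^ 2 := integral_add (iF.add (iXre.const_mul _)) (ik.const_mul _)
  have e2 : ∫ ξ in S, (‖𝓕 F ξ‖ ^ 2 + 2 * t * (starRingEnd ℂ (𝓕 F ξ) * 𝓕 k ξ).re)
      = (∫ ξ in S, ‖𝓕 F ξ‖ ^ 2) + ∫ ξ in S, 2 * t * (starRingEnd ℂ (𝓕 F ξ) * 𝓕 k ξ).re :=
    integral_add iF (iXre.const_mul _)
  have e3 : ∫ a in S, (starRingEnd ℂ (𝓕 F a) * 𝓕 k a).re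
      = (∫ ξ in S, starRingEnd ℂ (𝓕 F ξ) * 𝓕 k ξ).re := by
    have := integral_re iX
    simpa only [RCLike.re_to_complex] using this
  rw [e1, e2, integral_const_mul, integral_const_mul, e3]



/-- **Step 4 of L-EL.** Orthogonality of `H` to all inner perturbations forces `H` to be a.e.
constant on the inner zone. -/
theorem ae_eq_const_of_orthogonal_inner {lam : ℝ} (hlam : 0 < lam) {H : ℝ → ℂ}
    (heven : ∀ x, H (-x) = H x)
    (hH2 : MemLp (Set.indicator (Ioo (-(1 / lam)) (1 / lam)) H) 2)
    (horth : ∀ k : ℝ → ℂ, (∀ x, k (-x) = k x) →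
      Function.support k ⊆ Ioo (-(1 / lam)) (1 / lam) → ∫ x, k x = 0 → Integrable k →
      MemLp k 2 → ∫ x, starRingEnd ℂ (H x) * k x = 0) :
    ∃ α : ℂ, ∀ᵐ x ∂(volume.restrict (Ioo (-(1 / lam)) (1 / lam))), H x = α := by
  set I : Set ℝ := Ioo (-(1 / lam)) (1 / lam) with hI
  have hIm : MeasurableSet I := measurableSet_Ioo
  have hIfin : volume I < ⊤ := by simp [hI]
  -- `H ∈ L¹(I)` from `L²(I)` on a finite-measure set
  have hH2' : MemLp H 2 (volume.restrict I) :=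
    (memLp_indicator_iff_restrict hIm).mp hH2
  have hH1 : IntegrableOn H I := by
    haveI : IsFiniteMeasure (volume.restrict I) := ⟨by simpa using hIfin⟩
    exact hH2'.integrable one_le_two
  set c : ℂ := (∫ x in I, H x) / ((volume.real I : ℝ) : ℂ) with hc
  -- the test perturbation
  set k : ℝ → ℂ := I.indicator fun x ↦ H x - c with hk
  have hKc : MemLp (fun _ : ℝ ↦ c) 2 (volume.restrict I) := by
    haveI : IsFiniteMeasure (volume.restrict I) := ⟨by simpa using hIfin⟩
    exact memLp_const c
  have hk2r : MemLp (fun x ↦ H x - c) 2 (volume.restrict I) := hH2'.sub hKc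
  have hk2 : MemLp k 2 := (memLp_indicator_iff_restrict hIm).mpr hk2r
  have hk1r : IntegrableOn (fun x ↦ H x - c) I := by
    haveI : IsFiniteMeasure (volume.restrict I) := ⟨by simpa using hIfin⟩
    exact hk2r.integrable one_le_two
  have hk1 : Integrable k := (integrable_indicator_iff hIm).mpr hk1r
  have hvolI : volume.real I ≠ 0 := by
    have : 0 < 1 / lam - -(1 / lam) := by have := one_div_pos.mpr hlam; linarith
    rw [measureReal_def, hI, Real.volume_Ioo, ENNReal.toReal_ofReal this.le]
    exact this.ne'
  have hcv : ((volume.real I : ℝ) : ℂ) * c = ∫ x in I, H x := by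
    have : ((volume.real I : ℝ) : ℂ) ≠ 0 := Complex.ofReal_ne_zero.mpr hvolI
    rw [hc]; field_simp
  have hkeven : ∀ x, k (-x) = k x := by
    intro x
    have hmem : (-x ∈ I) ↔ (x ∈ I) := by
      simp only [hI, mem_Ioo]; constructor <;> rintro ⟨h1, h2⟩ <;> constructor <;> linarith
    by_cases hx : x ∈ I
    · rw [hk, indicator_of_mem hx, indicator_of_mem (hmem.mpr hx), heven]
    · rw [hk, indicator_of_notMem hx, indicator_of_notMem (fun h ↦ hx (hmem.mp h))]
  have hksupp : Function.support k ⊆ Ioo (-(1 / lam)) (1 / lam) := support_indicator_subset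
  have hkmean : ∫ x, k x = 0 := by
    rw [hk, integral_indicator hIm, integral_sub hH1 (integrableOn_const hIfin.ne),
      setIntegral_const, Complex.real_smul, hcv, sub_self]
  -- integrability facts on `I`
  have hsq : Integrable (fun x ↦ ‖H x‖ ^ 2) (volume.restrict I) :=
    (memLp_two_iff_integrable_sq_norm hH2'.1).mp hH2'
  have hsq' : Integrable (fun x ↦ ‖H x - c‖ ^ 2) (volume.restrict I) :=
    (memLp_two_iff_integrable_sq_norm hk2r.1).mp hk2r
  have hHH : IntegrableOn (fun x ↦ starRingEnd ℂ (H x) * H x) I := by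
    refine Integrable.mono' hsq ?_ (ae_of_all _ fun x ↦ ?_)
    · exact (Complex.continuous_conj.comp_aestronglyMeasurable hH1.aestronglyMeasurable).mul
        hH1.aestronglyMeasurable
    · rw [norm_mul, Complex.norm_conj, sq]
  have hHc : IntegrableOn (fun x ↦ starRingEnd ℂ (H x) * c) I := by
    refine Integrable.mono' (hH1.norm.mul_const ‖c‖) ?_ (ae_of_all _ fun x ↦ ?_)
    · exact (Complex.continuous_conj.comp_aestronglyMeasurable hH1.aestronglyMeasurable).mul
        aestronglyMeasurable_const
    · rw [norm_mul, Complex.norm_conj]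
  have hint1 : IntegrableOn (fun x ↦ starRingEnd ℂ (H x) * (H x - c)) I := by
    refine (hHH.sub hHc).congr (ae_of_all _ fun x ↦ ?_)
    simp only [Pi.sub_apply]
    ring
  have hint2 : IntegrableOn (fun x ↦ starRingEnd ℂ c * (H x - c)) I :=
    hk1r.const_mul _
  -- orthogonality applied to `k`, and to the constant
  have h1 : ∫ x in I, starRingEnd ℂ (H x) * (H x - c) = 0 := by
    have this := horth k hkeven hksupp hkmean hk1 hk2
    have hfun : (fun x ↦ starRingEnd ℂ (H x) * k x) =
        I.indicator (fun x ↦ starRingEnd ℂ (H x) * (H x - c)) := by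
      ext x
      by_cases hx : x ∈ I
      · rw [hk, indicator_of_mem hx, indicator_of_mem hx]
      · rw [hk, indicator_of_notMem hx, indicator_of_notMem hx, mul_zero]
    rwa [hfun, integral_indicator hIm] at this
  have h2 : ∫ x in I, starRingEnd ℂ c * (H x - c) = 0 := by
    rw [integral_const_mul, integral_sub hH1 (integrableOn_const hIfin.ne), setIntegral_const,
      Complex.real_smul, hcv, sub_self, mul_zero]
  -- hence `∫_I |H - c|² = 0`
  have h3 : ∫ x in I, ((‖H x - c‖ ^ 2 : ℝ) : ℂ) = 0 := by
    have h12 : ∫ x in I, (starRingEnd ℂ (H x) * (H x - c) - starRingEnd ℂ c * (H x - c)) = 0 := by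
      rw [integral_sub hint1 hint2, h1, h2, sub_zero]
    rw [← h12]
    refine integral_congr_ae (ae_of_all _ fun x ↦ ?_)
    simp only
    rw [← sub_mul, ← map_sub, Complex.conj_mul']
    push_cast
    ring
  have h4 : ∫ x in I, ‖H x - c‖ ^ 2 = 0 := by
    have := h3
    rw [integral_complex_ofReal] at this
    exact_mod_cast this
  have h5 : ∀ᵐ x ∂(volume.restrict I), ‖H x - c‖ ^ 2 = 0 :=
    (integral_eq_zero_iff_of_nonneg (fun x ↦ by positivity) hsq').mp h4
  exact ⟨c, h5.mono fun x hx ↦ by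
    have : ‖H x - c‖ = 0 := by simpa using pow_eq_zero_iff (n := 2) (by norm_num) |>.mp hx
    exact sub_eq_zero.mp (norm_eq_zero.mp this)⟩

/- STEP 2 (the calculus step: `a ≤ a + 2tL + t²c ∀ t ⟹ L = 0`) is ALREADY in the tree:
`Literature.Probability.LatticeModels.DiscreteRect.eq_zero_of_forall_le_add_quad`
(file `Literature/Probability/LatticeModels/DiscreteExtremalLengthExternalArcsSelfDual.lean`);
apply it to `t ↦ leakage λ (F + t·k)` via `leakage_add_mul`, and to `k ↦ I·k` for the imaginary
part. -/

end LatticeUncertainty.SlavedEL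

end Summit.RiemannHypothesis.RiemannHypothesis.Theorems
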